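/-
Copyright (c) 2026 the pub-hodgecm-mathlib formalisation cell (harness21).  Prover seat hodgecm-mathlib-K2Liu-p01 (g7), Track B «K2-LIT»,
#184♮ = hLiu418 = `stmt-HodgeConjecture-24832`; LEAD F0P6-plan (g13) DEAL 2026-09-04T10:11:36Z (2) (S1-F5), K2E5-plan (g7) «=» 10:20:03Z∕10:20:24Z
(ROUTE A of record; split F5a∕F5b = K2Liu-p01, F5c = K2Liu-p07).  #42S payer road, organ S1 (ROAD W, «M-157t»), file F5a.
-/
import Literature.NumberTheory.GelbartRogawski1991.LocalDoubledUnitaryBigCellForm   -- ★ `localLeray_val_eq_weilIndex_resQF` (second argument arbitrary), `transverseHerm`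
import Literature.NumberTheory.GelbartRogawski1991.LocalUnitarySplittingDatum       -- ★ `LocalSplittingDatum` (`beta`, `beta_mul`, `cocycle_eq`)
import HarnessLib

/-!
# Crux `HLiu418`, #42S organ S1 (ROAD W), file F5a: KUDLA'S `β` AT ANY ELEMENT VIA ONE BIG-CELL TRANSLATE —
# `β(b) = β(a)⁻¹ · β(a b) · c(ι a, ι b)`, and on the doubled group `c(ι a, ι b) = γ_{ψ′}(Res H(a, b))` as soon as `a`, `a b` lie in the big cell

Cell `hodgecm-mathlib`, crux item hLiu418 = `stmt-HodgeConjecture-24832` (helper lane `--supports … --as helper`, count-neutral).  THEOREMS ONLY (no `def`, no instance,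
no notation, no named-fact hypothesis, no `sorry`).

WHY (census 10:19:03Z, Route A for S1-F5 `K2LiuLocalSWRelativeWeilIndex`).  ROAD W's witness needs Kudla's splitting at the MIDDLE Weyl element `w₁` (not in the big cell
`Ω_H`, where the tree knows `β = κ·χ_w(det C)⁻¹`).  The splitting identity of ★ `LocalSplittingDatum` (`beta_mul : β(g₁g₂)·c_r(ιg₁, ιg₂) = β(g₁)β(g₂)` for ALL pairs)
solves for `β(b)` from `β(a)`, `β(ab)` and ONE cocycle value; ★ `localLeray_val_eq_weilIndex_resQF` evaluates that value as the Weil index of the restriction of scalars of the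
transverse hermitian matrix `H(a, b)` under the hypotheses `C_a`, `C_{ab}` invertible ONLY — `b` itself is arbitrary, so `b = w₁` is allowed (then `H(a, w₁)` is degenerate, and ★ F5b
`K2LiuWeilIndexResHermitianDegenerate.weilIndexSpace_resQF_of_diag` evaluates its index).
* §1 (ANY local splitting datum `D` over `ι : U(J)(F_v) → Sp(𝕎_v)`): **`beta_eq_of_translate`** — `β(b) = β(a)⁻¹ · (β(a b) · c_r(ι a, ι b))` in `ℂˣ`; the `ℂ`-valued form
  `coe_beta_eq_of_translate`; with a cocycle identification `c_r = c^{ψ′}_ℓ` (the shape of ★ `exists_beta_nonsplit`'s `hr`): `coe_beta_eq_of_translate_localLeray`.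
* §2 (the DOUBLED group `H = U(T₀ ⊕ −T₀)(F_v)`, Lagrangian `ℓ_Δ`, any datum over `ι^𝔻`): **`coe_beta_eq_weilIndex_of_translate`** — for `C_a`, `C_{ab}` invertible,
  `β(b) = β(a)⁻¹ · β(a b) · γ_{ψ′}(Res H(a, b))`; and the TWO-DATA RATIO bookkeeping `ratio_eq_of_translate` (pure algebra: the shape F5c consumes for `β⁺(w₁)∕β⁻(w₁)`).
NOT here (F5a-bis if F5c needs it by name): «`β|_Ω = κ·χ_w(det C)⁻¹` for the datum of record» (★ `beta_of_bigCell` lift + ★ `LocalKudlaSplittingUniqueness`); F5c may equally take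
the two big-cell values `β(a)`, `β(a w₁)` BY VALUE from ★ `exists_kudla_bigCell_function`'s `φ` once the datum is identified with the lift.
[Kudla1994, §3 Thm. 3.1] [HarrisKudlaSweet1996, §1 (1.14)–(1.16)] [Weil1964, n° 42 Lemme 6, n° 43].
HONEST LABEL.  Count-neutral helper; `HC_CM` is proved only modulo the 7 printed citations (2 remaining named inputs: hLiu418 = `stmt-HodgeConjecture-24832`,
h413 = `stmt-HodgeConjecture-24833`) until rung 0 closes.

## References
* [Kudla1994] S. S. Kudla, *Splitting metaplectic covers of dual reductive pairs*, Israel J. Math. 87 (1994), §3, Thm. 3.1.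
* [HarrisKudlaSweet1996] M. Harris, S. S. Kudla, W. J. Sweet, J. Amer. Math. Soc. 9 (1996), §1 (1.14)–(1.16).
* [Weil1964] A. Weil, Acta Math. 111 (1964), n° 42 Lemme 6, n° 43 (group chunks).
-/

set_option autoImplicit false
set_option linter.dupNamespace false -- the mandated namespace repeats `HodgeConjecture.HodgeConjecture`

noncomputable section

open NumberField IsDedekindDomain MeasureTheory Matrix
open Literature.RepresentationTheory.HeisenbergGroup
open Literature.NumberTheory.Automorphic Literature.NumberTheory.Automorphic.UnitaryGroup Literature.NumberTheory.Weil1964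
open Literature.NumberTheory.GelbartRogawski1991 Literature.NumberTheory.GelbartRogawski1991.UnitaryDualPair
open Literature.NumberTheory.GelbartRogawski1991.UnitaryDualPair.LocalSplitting
open Literature.NumberTheory.GelbartRogawski1991.AdaptedBlocks

namespace Summit.HodgeConjecture.HodgeConjecture.Cruxes.HLiu418.K2LiuKudlaBetaViaBigCellTranslate

variable (F : Type) [Field F] [NumberField F] (E : Type) [Field E] [NumberField E] [Algebra F E]
  [Algebra.IsQuadraticExtension F E] (c : E ≃ₐ[F] E)
  {δ : E} (hcδ : c δ = -δ) (hδ : δ ≠ 0) {d : F} (hd : δ * δ = algebraMap F E d)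
  (v : HeightOneSpectrum (𝓞 F))
  [MeasurableSpace (v.adicCompletion F)] [BorelSpace (v.adicCompletion F)]
  (μ : Measure (v.adicCompletion F)) [μ.IsAddHaarMeasure]

/-! ## §1 Any local splitting datum: `β(b)` from `β(a)`, `β(ab)` and one cocycle value -/

section Any

variable {F E c hcδ hδ hd v μ} {N : ℕ} {T : Matrix (Fin N) (Fin N) F} {hT : T.IsSymm} {hTd : IsUnit T.det}
  {J : Matrix (Fin N) (Fin N) E} {hJ : J = T.map (algebraMap F E)}
  {ℓ : Submodule (v.adicCompletion F) ((Fin N → v.adicCompletion F) × (Fin N → v.adicCompletion F))}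
  {hℓ : LinearMap.BilinForm.orthogonal (alt (polar (localPairing F N T v))) ℓ = ℓ}
  (D : LocalSplittingDatum F E c N hcδ hδ hd T hT hTd hJ v μ ℓ hℓ)

/-- **`β` AT ANY ELEMENT VIA ONE TRANSLATE**: `β(b) = β(a)⁻¹ · (β(a b) · c_r(ι a, ι b))` — the splitting identity `β(ab)·c_r(ιa, ιb) = β(a)β(b)` of ★ `LocalSplittingDatum`
solved for `β(b)`. [cite: Kudla1994, Thm 3.1] [cite: Weil1964, n° 42 Lemme 6] -/
theorem beta_eq_of_translate (a b : UnitaryGroup.localPi E c N J v) :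
    D.beta b = (D.beta a)⁻¹ * (D.beta (a * b) * D.r.cocycle D.hU (iota F E c N hcδ hδ hd T hT hJ v a) (iota F E c N hcδ hδ hd T hT hJ v b)) := by
  rw [D.beta_mul a b, inv_mul_cancel_left]

/-- the `ℂ`-valued form: `β(b) = β(a)⁻¹ · β(ab) · c_r(ιa, ιb)`. [cite: Kudla1994, Thm 3.1] -/
theorem coe_beta_eq_of_translate (a b : UnitaryGroup.localPi E c N J v) :
    ((D.beta b : ℂˣ) : ℂ) = ((D.beta a : ℂˣ) : ℂ)⁻¹ * ((D.beta (a * b) : ℂˣ) : ℂ) *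
      ((D.r.cocycle D.hU (iota F E c N hcδ hδ hd T hT hJ v a) (iota F E c N hcδ hδ hd T hT hJ v b) : ℂˣ) : ℂ) := by
  rw [beta_eq_of_translate D a b, Units.val_mul, Units.val_mul, Units.val_inv_eq_inv_val, mul_assoc]

/-- the same with the cocycle IDENTIFIED with a Leray cocycle `c^{ψ′}_ℓ` (the shape of ★ `exists_beta_nonsplit`'s `hr` ∕ ★ `LocalSplittingDatum.cocycle_eq`'s witness):
`β(b) = β(a)⁻¹ · β(ab) · c^{ψ′}_ℓ(ιa, ιb)`. [cite: Kudla1994, Thm 3.1] [cite: HarrisKudlaSweet1996, §1 (1.14)] -/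
theorem coe_beta_eq_of_translate_localLeray {ψ' : AddChar (v.adicCompletion F) Circle} {hψ' : ψ'.IsContinuousNontrivial}
    (hc : ∀ g₁ g₂ : LocalSp F N T v, D.r.cocycle D.hU g₁ g₂ = localLeray F N T hTd v μ ψ' hψ' ℓ hℓ g₁ g₂) (a b : UnitaryGroup.localPi E c N J v) :
    ((D.beta b : ℂˣ) : ℂ) = ((D.beta a : ℂˣ) : ℂ)⁻¹ * ((D.beta (a * b) : ℂˣ) : ℂ) *
      ((localLeray F N T hTd v μ ψ' hψ' ℓ hℓ (iota F E c N hcδ hδ hd T hT hJ v a) (iota F E c N hcδ hδ hd T hT hJ v b) : ℂˣ) : ℂ) := by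
  rw [coe_beta_eq_of_translate D a b, hc]

/-- bookkeeping: `β(a) ≠ 0`, so the translate formula can be cleared of denominators: `β(a)·β(b) = β(ab)·c_r(ιa, ιb)`. [cite: Kudla1994, Thm 3.1] -/
theorem coe_beta_mul_coe_beta (a b : UnitaryGroup.localPi E c N J v) :
    ((D.beta a : ℂˣ) : ℂ) * ((D.beta b : ℂˣ) : ℂ) =
      ((D.beta (a * b) : ℂˣ) : ℂ) * ((D.r.cocycle D.hU (iota F E c N hcδ hδ hd T hT hJ v a) (iota F E c N hcδ hδ hd T hT hJ v b) : ℂˣ) : ℂ) := by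
  have h := congrArg Units.val (D.beta_mul a b)
  simpa only [Units.val_mul] using h.symm

end Any

/-! ## §2 The doubled group: the cocycle value as a Weil index (big-cell hypotheses on `a`, `ab` only) -/

section Doubled

/-- **`β(b) = β(a)⁻¹ · β(ab) · γ_{ψ′}(Res H(a, b))` ON THE DOUBLED GROUP** for ANY splitting datum over `ι^𝔻` whose cocycle is the Leray cocycle of `ℓ_Δ` at `ψ′`, and `a`, `ab` in the
big cell (`C_a`, `C_{ab}` invertible) — `b` ARBITRARY (middle-cell `b = w₁` included; then `H(a, w₁)` is degenerate and ★ F5b evaluates its index).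
[cite: Kudla1994, §3 Thm 3.1] [cite: HarrisKudlaSweet1996, §1 (1.14)–(1.16)] -/
theorem coe_beta_eq_weilIndex_of_translate (n : ℕ) {T₀ : Matrix (Fin n) (Fin n) F} (hT₀ : T₀.IsSymm) (hT₀d : IsUnit T₀.det)
    {JD : Matrix (Fin (n + n)) (Fin (n + n)) E} (hJD : JD = (gramD F n T₀).map (algebraMap F E))
    (D : LocalSplittingDatum F E c (n + n) hcδ hδ hd (gramD F n T₀) (gramD_isSymm F n hT₀) (isUnit_det_gramD F n hT₀d) hJD v μ
      (deltaLagrangian F v n) (deltaLagrangian_orthogonal F v n T₀ hT₀d))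
    {ψ' : AddChar (v.adicCompletion F) Circle} {hψ' : ψ'.IsContinuousNontrivial}
    (hc : ∀ g₁ g₂ : LocalSp F (n + n) (gramD F n T₀) v, D.r.cocycle D.hU g₁ g₂ =
      localLeray F (n + n) (gramD F n T₀) (isUnit_det_gramD F n hT₀d) v μ ψ' hψ' (deltaLagrangian F v n) (deltaLagrangian_orthogonal F v n T₀ hT₀d) g₁ g₂)
    (a b : UnitaryGroup.localPi E c (n + n) JD v)
    (ha : IsUnit (blkC (matA F E c v n a))) (hab : IsUnit (blkC (matA F E c v n (a * b)))) :
    ((D.beta b : ℂˣ) : ℂ) = ((D.beta a : ℂˣ) : ℂ)⁻¹ * ((D.beta (a * b) : ℂˣ) : ℂ) *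
      weilIndexSpace ψ' μ (resQF (isQuadraticCoordinates_local E v c hcδ hδ hd) (conjLocal E c v) (conjLocal_toLocalRing c v)
        (transverseHerm F E c v n δ d T₀ a b)) := by
  rw [coe_beta_eq_of_translate_localLeray D hc a b]
  -- `iota … (gramD …) = iotaD …` definitionally
  show ((D.beta a : ℂˣ) : ℂ)⁻¹ * ((D.beta (a * b) : ℂˣ) : ℂ) *
      ((localLeray F (n + n) (gramD F n T₀) (isUnit_det_gramD F n hT₀d) v μ ψ' hψ' (deltaLagrangian F v n)
        (deltaLagrangian_orthogonal F v n T₀ hT₀d) (iotaD F E c hcδ hδ hd v n hT₀ hJD a) (iotaD F E c hcδ hδ hd v n hT₀ hJD b) : ℂˣ) : ℂ) = _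
  rw [localLeray_val_eq_weilIndex_resQF F E c hcδ hδ hd v n hT₀ hT₀d hJD μ hψ' a b ha hab]

/-- **TWO-DATA RATIO BOOKKEEPING** (pure algebra; the shape F5c consumes): from `β^ε(b^ε) = β^ε(a^ε)⁻¹ · β^ε(a^ε b^ε) · γ^ε` for `ε = ±` with all `β`-values and `γ⁻` non-zero,
`β⁺(b⁺) ∕ β⁻(b⁻) = (β⁻(a⁻) ∕ β⁺(a⁺)) · (β⁺(a⁺b⁺) ∕ β⁻(a⁻b⁻)) · (γ⁺ ∕ γ⁻)`. [cite: Kudla1994, Thm 3.1] -/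
theorem ratio_eq_of_translate {βa₁ βab₁ γ₁ βb₁ βa₂ βab₂ γ₂ βb₂ : ℂ} (ha₁ : βa₁ ≠ 0) (ha₂ : βa₂ ≠ 0) (hab₂ : βab₂ ≠ 0) (hγ₂ : γ₂ ≠ 0)
    (h₁ : βb₁ = βa₁⁻¹ * βab₁ * γ₁) (h₂ : βb₂ = βa₂⁻¹ * βab₂ * γ₂) :
    βb₁ / βb₂ = (βa₂ / βa₁) * (βab₁ / βab₂) * (γ₁ / γ₂) := by
  rw [h₁, h₂]
  field_simp

/-- and if the auxiliary big-cell values AGREE between the two data (`β⁺(a) = β⁻(a)`, `β⁺(ab) = β⁻(ab)` — e.g. the same `κ·χ_w(det C)⁻¹` up to factors that cancel), the ratio IS the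
ratio of the two Weil indices: `β⁺(b) ∕ β⁻(b) = γ⁺ ∕ γ⁻`. [cite: Kudla1994, Thm 3.1] [cite: HarrisKudlaSweet1996, §1 (1.16)] -/
theorem ratio_eq_weilIndex_ratio_of_agree {βa βab γ₁ βb₁ γ₂ βb₂ : ℂ} (ha : βa ≠ 0) (hab : βab ≠ 0) (hγ₂ : γ₂ ≠ 0)
    (h₁ : βb₁ = βa⁻¹ * βab * γ₁) (h₂ : βb₂ = βa⁻¹ * βab * γ₂) : βb₁ / βb₂ = γ₁ / γ₂ := by
  rw [ratio_eq_of_translate ha ha hab hγ₂ h₁ h₂, div_self ha, div_self hab, one_mul, one_mul]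

end Doubled

end Summit.HodgeConjecture.HodgeConjecture.Cruxes.HLiu418.K2LiuKudlaBetaViaBigCellTranslate

end
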